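import Summits.BirchSwinnertonDyer.Rank1Residual.ManinAdditive.QuarterShiftTwistOrbit
import Summits.BirchSwinnertonDyer.BirchSwinnertonDyer.Theorems.ManinLocalTwoThreeShimuraTwoCharOfPeriods
import Literature.NumberTheory.EllipticCurves.PeriodLatticeGamma1QuotientProofs
import Literature.NumberTheory.EllipticCurves.Gamma1PeriodLatticeTwistProofs
import HarnessLib

/-!
# The QUARTER-SHIFT transfer RESPECTS `Γ₁`: `Λ₁(f) = s·Λ₁(g)` along every `χ₋₄` edge `N ∣ N′ ∣ 4N`, `16 ∣ N′` — so the SHIMURA QUOTIENT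
# `Λ₀/Λ₁` (its index, «Stevens' curve = the optimal curve», index `4`) is a `χ₋₄`-ORBIT INVARIANT (unconditional)
(route `ManinLocalTwoThree`, deciding crux C2 `ManinOddAtFour` stmt-BirchSwinnertonDyer-22967; cell bsd-f2-manin, C2/C3 LEAD p1 gen 18;
`--supports stmt-BirchSwinnertonDyer-22967`; the `Γ₁` twin of es's THEOREM 55.D `…ManinAdditive.QuarterShiftTwist(Orbit)` (p742052 / `…QuarterShiftTwistOrbit`), which is
the `Γ₀` statement `Λ₀(g) = s⁻¹Λ₀(f)`)

THE POINT.  es g34 proved that along a quarter-shift pair `{∞, r}_f = s·{∞, r + ¼}_g` (`f` on `Γ₀(N)`, `g` on `Γ₀(N′)`, `N ∣ N′ ∣ 4N`,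
`16 ∣ N′`; it HOLDS with `s² = −1` for the newforms of a `χ₋₄`-pair `W′ ~ W ⊗ χ₋₄`, both additive at `2`) the `Γ₀`-period lattices
correspond: `Λ₀(f) = s·Λ₀(g)`.  Here: **the `Γ₁(N)`-period lattices correspond too, `Λ₁(f) = s·Λ₁(g)`** (§1–§3).  The two new
inputs are (i) Shimura's conjugate matrix KEEPS the lower-right entry modulo `c/4` (tree `exists_sl2_div_eq_div_add_twistShift`:
`c ∣ 4(d′ − d)`), and (ii) CUSPIDAL INERTIA at the cusp of denominator `N′/4`: at level `N` (resp. `N′`) every `γ` with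
`d_γ ≡ 1 (mod N′/4)` has `{∞, γ∞} ∈ Λ₁` (the parabolic `(1 − tc₀, t; −c₀², 1 + tc₀)`, `c₀ = N′/4`, `N ∣ c₀²`, tree `exists_parabolic_fixing`),
which absorbs both the coset descent `Γ₀(N) = ⊔ Γ₀(4N)(1 0; kN 1)` and the loss `d ↦ d + (c/4)·k`.
CONSEQUENCES (all UNCONDITIONAL; §4, for any `s ≠ 0`):
* `relIndex_periodLatticeGamma1_eq_of_quarterShift`: **`[Λ₀(f) : Λ₁(f)] = [Λ₀(g) : Λ₁(g)]`** (`AddSubgroup.relIndex`) — the ORDER OF THE SHIMURA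
  QUOTIENT (the kernel of Stevens' covering `E₁ → E₀`) is the same at both ends of the edge;
* `periodLatticeGamma1_eq_iff_of_quarterShift`: **`Λ₁(f) = Λ₀(f) ⟺ Λ₁(g) = Λ₀(g)`** («Stevens' `X₁`-optimal curve IS the `X₀`-optimal curve» is a
  `χ₋₄`-orbit property);
* `periodLatticeGamma1_eq_two_mul_iff_of_quarterShift`: **index `4` (`Λ₁ = 2Λ₀`, the negation of E-an-152b) at `f` ⟺ at `g`**.
The specialisation to `χ₋₄`-PAIRS of modular-parametrisation data (the rotation `Λ₁(f_{D′}) = i·Λ₁(f_D)` next to es's `Λ₀(f_{D′}) = i·Λ₀(f_D)`)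
and the NEW LEVELS it yields (`16q^e` from `4q^e`, `16pq` from `4pq`) are the sequel `…ManinLocalTwoThreeQuarterShiftGamma1Orbit`.
CENSUS SHADOW (HOME/p1/g15/CENSUS-shimura-levels-p1-g15.md, es E15): the 49 index-`2` classes `N ≤ 75092` come in `χ₋₄`-twin pairs
`4p ↔ 16p` (`20a1/80b1`, `52a1/208c1`, `116c1/464e1`, `212b1/848d1`, `692a1/2768c1`, …, `24a1/48a1`, `40a1/80a1`) — exactly as the theorem
predicts.  HONEST FRAMING: unconditional structure theorems about the tree's period lattices; which index occurs is NOT decided; C2, E-an-152b,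
Manin's conjecture and BSD are NOT proved by this file.  No definitions, no named facts, no sorry.
[cite: Stevens1989, §2 (the Shimura covering E₁ → E₀, Λ₁ ⊆ Λ₀) and Lemma (5.4) p. 97 (twisting the Γ₁-lattice)] [cite: Shimura1971, Prop. 3.64]
[cite: LingOesterle1991, §1 (cuspidal inertia / structure of Σ(N))] [cite: Manin1972, Prop. 1.4 / Thm. 1.6]
-/

set_option autoImplicit false
-- lint-debt: the directory name repeats the summit name (sibling precedent `ManinLocalTwoThreeShimuraQuotientHeckeAtFour.lean`)
set_option linter.dupNamespace false

noncomputable section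

open scoped MatrixGroups ModularForm
open CongruenceSubgroup Complex
open WeierstrassCurve Literature.NumberTheory.EllipticCurves Literature.NumberTheory.EllipticCurves.ModularForms
open Literature.NumberTheory.Automorphic (lowerSL lowerSL_apply_00 lowerSL_apply_01 lowerSL_apply_10
  lowerSL_apply_11 SL_mul_apply_10 SL_mul_apply_00)
open Summit.BirchSwinnertonDyer.Rank1Residual.ManinAdditive (QuarterShiftSymbols lowerGamma0 coe_lowerGamma0
  cuspSymbol_lowerGamma0 mem_gamma0_of_dvd cuspSymbol_eq_of_ne_zero smul_periodLattice_le_of_quarterShift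
  periodLattice_le_smul_of_quarterShift_of_dvd periodLattice_iff_of_quarterShift_of_dvd
  exists_quarterShiftSymbols_of_negOne_twist IsLatticeOptimal)

namespace Summit.BirchSwinnertonDyer.BirchSwinnertonDyer.Theorems.ManinLocalTwoThree.SigmaHabitat

/-! ## §0 Level arithmetic and the two matrix inputs -/

/-- The level arithmetic of a `χ₋₄` edge: `N ∣ N′ ∣ 4N`, `16 ∣ N′` ⟹ with `c₀ = N′/4`: `N′ = 4c₀`, `c₀ ∣ N`, `N ∣ c₀²`, `N′ ∣ c₀²`. -/
theorem exists_quarter_level {N N' : ℕ} [NeZero N] (hNN' : N ∣ N') (hN'4 : N' ∣ 4 * N) (h16 : 4 ^ 2 ∣ N') :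
    ∃ c₀ : ℕ, N' = 4 * c₀ ∧ c₀ ∣ N ∧ (N : ℤ) ∣ (c₀ : ℤ) ^ 2 ∧ (N' : ℤ) ∣ (c₀ : ℤ) ^ 2 := by
  have hN0 : N ≠ 0 := NeZero.ne N
  obtain ⟨t, ht⟩ := hNN'
  obtain ⟨t', ht'⟩ := hN'4
  have htt' : t * t' = 4 := by
    have h : N * (t * t') = N * 4 := by rw [← mul_assoc, ← ht, ← ht']; ring
    exact Nat.eq_of_mul_eq_mul_left (Nat.pos_of_ne_zero hN0) h
  have ht4 : t ∣ 4 := ⟨t', htt'.symm⟩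
  have htpos : 0 < t := Nat.pos_of_ne_zero fun h ↦ by rw [h, zero_mul] at htt'; exact absurd htt' (by norm_num)
  have htle : t ≤ 4 := Nat.le_of_dvd (by norm_num) ht4
  obtain ⟨c₁, hc₁⟩ : 16 ∣ N' := by norm_num at h16; exact h16
  interval_cases t
  · -- `N' = N`, `16 ∣ N`
    refine ⟨4 * c₁, by omega, ⟨4, by omega⟩, ⟨c₁, ?_⟩, ⟨c₁, ?_⟩⟩
    · have : (N : ℤ) = 16 * c₁ := by exact_mod_cast (by omega : N = 16 * c₁)
      rw [this]; push_cast; ring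
    · have : (N' : ℤ) = 16 * c₁ := by exact_mod_cast hc₁
      rw [this]; push_cast; ring
  · -- `N' = 2N`, `8 ∣ N`
    refine ⟨4 * c₁, by omega, ⟨2, by omega⟩, ⟨2 * c₁, ?_⟩, ⟨c₁, ?_⟩⟩
    · have : (N : ℤ) = 8 * c₁ := by exact_mod_cast (by omega : N = 8 * c₁)
      rw [this]; push_cast; ring
    · have : (N' : ℤ) = 16 * c₁ := by exact_mod_cast hc₁
      rw [this]; push_cast; ring
  · omega
  · -- `N' = 4N`
    refine ⟨N, by omega, dvd_rfl, ⟨N, by ring⟩, ⟨c₁, ?_⟩⟩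
    have hN : (N : ℤ) = 4 * c₁ := by exact_mod_cast (by omega : N = 4 * c₁)
    have hN'' : (N' : ℤ) = 16 * c₁ := by exact_mod_cast hc₁
    rw [hN, hN'']; ring

/-- **Cuspidal inertia at the cusp of denominator `c₀`** (`M ∣ c₀²`): `c₀ ∣ d_γ − 1 ⟹ {∞, γ∞}_h ∈ Λ₁(h)` — the parabolic
`(1 − tc₀, t; −c₀², 1 + tc₀) ∈ Γ₀(M)` has zero period and lower-right entry `d_γ` (tree `exists_parabolic_fixing`).
[cite: Manin1972, Prop. 1.4 / Thm. 1.6] [cite: LingOesterle1991, §1] -/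
theorem cuspSymbol_mem_periodLatticeGamma1_of_dvd_sub_one {M : ℕ} [NeZero M] (h : CuspForm (Gamma0 M) 2) {c₀ : ℕ}
    (hM : (M : ℤ) ∣ (c₀ : ℤ) ^ 2) (γ : Gamma0 M) (hd : (c₀ : ℤ) ∣ ((γ : SL(2, ℤ)) 1 1 : ℤ) - 1) :
    cuspSymbol h γ ∈ periodLatticeGamma1 h := by
  obtain ⟨t, ht⟩ := hd
  obtain ⟨ρ, hρ0, hρ11⟩ := exists_parabolic_fixing h t (c₀ : ℤ) 1 (by rwa [one_mul])
  have hdd : ((ρ : SL(2, ℤ)) 1 1 : ℤ) = ((γ : SL(2, ℤ)) 1 1 : ℤ) := by rw [hρ11]; linear_combination -ht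
  have hsub := cuspSymbol_sub_mem_periodLatticeGamma1_of_apply_eq h ρ γ (by rw [hdd])
  rwa [hρ0, sub_zero] at hsub

/-- Shimura's conjugate matrix inside `Γ₀(L)` (`m² ∣ L`, `c ≠ 0`, `u mod m`): same lower-left entry `c`, `γ′∞ = γ∞ + u/m`, AND
`c ∣ m·(d′ − d)` — the lower-right entry is kept modulo `c/m` (tree `exists_sl2_div_eq_div_add_twistShift`; es's wrapper
`exists_gamma0_cusp_add_twistShift` drops this clause). [cite: Shimura1971, Prop. 3.64] -/
theorem exists_gamma0_cusp_add_twistShift_apply {L m : ℕ} [NeZero m] (hm : m ^ 2 ∣ L) (γ : Gamma0 L)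
    (hc0 : (γ : SL(2, ℤ)) 1 0 ≠ 0) (u : ZMod m) :
    ∃ γ' : Gamma0 L, (γ' : SL(2, ℤ)) 1 0 = (γ : SL(2, ℤ)) 1 0 ∧
      ((γ : SL(2, ℤ)) 1 0 ∣ (m : ℤ) * (((γ' : SL(2, ℤ)) 1 1 : ℤ) - ((γ : SL(2, ℤ)) 1 1 : ℤ))) ∧
      (((γ' : SL(2, ℤ)) 0 0 : ℤ) : ℚ) / (((γ' : SL(2, ℤ)) 1 0 : ℤ) : ℚ) =
        (((γ : SL(2, ℤ)) 0 0 : ℤ) : ℚ) / (((γ : SL(2, ℤ)) 1 0 : ℤ) : ℚ) + twistShift u := by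
  obtain ⟨γ', h10, h11, h⟩ := exists_sl2_div_eq_div_add_twistShift (γ : SL(2, ℤ)) (sq_dvd_entry_of_mem_Gamma0 hm γ.2) hc0 u
  exact ⟨⟨γ', mem_Gamma0_of_entry_eq dvd_rfl γ.2 h10⟩, h10, h11, h⟩

/-- **Coset descent keeping `d`**: `Γ₀(N) = ⊔ₖ Γ₀(4N)·(1 0; kN 1)` for `2 ∣ N` — every `δ ∈ Γ₀(N)` has a `δ₁ = δ·(1 0; −kN 1) ∈ Γ₀(4N)`
with the SAME lower-right entry and the same period (es's `exists_mem_gamma0_four_mul_cuspSymbol_eq`, entry recorded). -/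
theorem exists_mem_gamma0_four_mul_apply_eq_cuspSymbol_eq {N : ℕ} [NeZero N] (h2 : 2 ∣ N)
    (f : CuspForm (Gamma0 N) 2) (δ : Gamma0 N) :
    ∃ δ₁ : Gamma0 N, (δ₁ : SL(2, ℤ)) ∈ Gamma0 (4 * N) ∧ (δ₁ : SL(2, ℤ)) 1 1 = (δ : SL(2, ℤ)) 1 1 ∧
      cuspSymbol f δ = cuspSymbol f δ₁ := by
  obtain ⟨c₁, hc₁⟩ : (N : ℤ) ∣ (δ : SL(2, ℤ)) 1 0 := by
    have h := δ.2
    rw [Gamma0_mem, ZMod.intCast_zmod_eq_zero_iff_dvd] at h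
    exact h
  have hdet : (δ : SL(2, ℤ)) 0 0 * (δ : SL(2, ℤ)) 1 1 - (δ : SL(2, ℤ)) 0 1 * (δ : SL(2, ℤ)) 1 0 = 1 := by
    have h := Matrix.SpecialLinearGroup.det_coe (δ : SL(2, ℤ))
    rw [Matrix.det_fin_two] at h
    exact h
  obtain ⟨n₂, hn₂⟩ := h2
  have hN2 : (N : ℤ) = 2 * (n₂ : ℤ) := by exact_mod_cast hn₂
  have hd_odd : Odd ((δ : SL(2, ℤ)) 1 1) := by
    rw [← Int.not_even_iff_odd]
    rintro ⟨e, he⟩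
    have h2dvd : (2 : ℤ) ∣ 1 :=
      ⟨(δ : SL(2, ℤ)) 0 0 * e - (δ : SL(2, ℤ)) 0 1 * ((n₂ : ℤ) * c₁), by
        linear_combination -hdet + (δ : SL(2, ℤ)) 0 0 * he - (δ : SL(2, ℤ)) 0 1 * hc₁
          - (δ : SL(2, ℤ)) 0 1 * c₁ * hN2⟩
    omega
  obtain ⟨m, hm⟩ := hd_odd
  set k : ℤ := (δ : SL(2, ℤ)) 1 1 * c₁ with hk
  refine ⟨δ * lowerGamma0 N (-k), ?_, ?_, ?_⟩
  · rw [Gamma0_mem, ZMod.intCast_zmod_eq_zero_iff_dvd]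
    have e10 : ((δ * lowerGamma0 N (-k) : Gamma0 N) : SL(2, ℤ)) 1 0 =
        (δ : SL(2, ℤ)) 1 0 * 1 + (δ : SL(2, ℤ)) 1 1 * (-k * N) := by
      rw [Subgroup.coe_mul, coe_lowerGamma0, SL_mul_apply_10, lowerSL_apply_00, lowerSL_apply_10]
    rw [e10, hk, hc₁, hm]
    refine ⟨-(c₁ * m * (m + 1)), ?_⟩
    push_cast
    ring
  · rw [Subgroup.coe_mul, coe_lowerGamma0]
    simp [Matrix.mul_apply, Fin.sum_univ_two, lowerSL_apply_01, lowerSL_apply_11]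
  · rw [cuspSymbol_mul_holds f δ (lowerGamma0 N (-k)), cuspSymbol_lowerGamma0, add_zero]

/-! ## §1 The easy inclusion `s·Λ₁(g) ⊆ Λ₁(f)` -/

/-- **`s·Λ₁(g) ⊆ Λ₁(f)`** for a quarter-shift pair with `N ∣ N′ ∣ 4N`, `16 ∣ N′`: a `Γ₁(N′)`-period `{∞, a/c}_g` is
`s⁻¹{∞, a/c + ¾}_f = s⁻¹{∞, γ′∞}_f` with Shimura's `γ′ ∈ Γ₀(N′) ≤ Γ₀(N)`, `d_{γ′} ≡ d ≡ 1 (mod N′/4)`, and cuspidal inertia at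
`c₀ = N′/4` (`N ∣ c₀²`) puts that period in `Λ₁(f)`. [cite: Stevens1989, Lemma (5.4) p. 97] [cite: Shimura1971, Prop. 3.64] -/
theorem smul_periodLatticeGamma1_le_of_quarterShift {N N' : ℕ} [NeZero N] [NeZero N'] (hNN' : N ∣ N')
    (hN'4 : N' ∣ 4 * N) (h16 : 4 ^ 2 ∣ N') {s : ℂ} {f : CuspForm (Gamma0 N) 2} {g : CuspForm (Gamma0 N') 2}
    (h : QuarterShiftSymbols s f g) : ∀ w ∈ periodLatticeGamma1 g, s * w ∈ periodLatticeGamma1 f := by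
  haveI : NeZero (4 : ℕ) := ⟨by norm_num⟩
  obtain ⟨c₀, hN'c, -, hNc, -⟩ := exists_quarter_level hNN' hN'4 h16
  intro w hw
  induction hw using AddSubgroup.closure_induction with
  | mem x hx =>
    obtain ⟨γ₁, rfl⟩ := hx
    change s * cuspSymbol g ⟨(γ₁ : SL(2, ℤ)), Gamma1_in_Gamma0 N' γ₁.2⟩ ∈ periodLatticeGamma1 f
    set γ : Gamma0 N' := ⟨(γ₁ : SL(2, ℤ)), Gamma1_in_Gamma0 N' γ₁.2⟩ with hγdef
    have hγ1 := (Gamma1_mem N' (γ₁ : SL(2, ℤ))).mp γ₁.2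
    have hd1 : (((γ : SL(2, ℤ)) 1 1 : ℤ) : ZMod N') = 1 := hγ1.2.1
    by_cases hc0 : (γ : SL(2, ℤ)) 1 0 = 0
    · rw [cuspSymbol, if_pos hc0, mul_zero]
      exact AddSubgroup.zero_mem _
    · obtain ⟨γ', h10, h11, hdiv⟩ := exists_gamma0_cusp_add_twistShift_apply h16 γ hc0 (3 : ZMod 4)
      rw [Summit.BirchSwinnertonDyer.Rank1Residual.ManinAdditive.twistShift_three_four] at hdiv
      have hc0' : (γ' : SL(2, ℤ)) 1 0 ≠ 0 := by rw [h10]; exact hc0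
      set γN : Gamma0 N := ⟨(γ' : SL(2, ℤ)), mem_gamma0_of_dvd hNN' γ'.2⟩ with hγN
      have hcoe : (γN : SL(2, ℤ)) = (γ' : SL(2, ℤ)) := rfl
      have key : s * cuspSymbol g γ = cuspSymbol f γN := by
        rw [cuspSymbol_eq_of_ne_zero g γ hc0, cuspSymbol_eq_of_ne_zero f γN (by rw [hcoe]; exact hc0'),
          hcoe, hdiv]
        set q : ℚ := (((γ : SL(2, ℤ)) 0 0 : ℤ) : ℚ) / (((γ : SL(2, ℤ)) 1 0 : ℤ) : ℚ) with hq
        have h1 := h (q + 3 / 4 + ((-1 : ℤ) : ℚ))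
        rw [modularSymbol_add_intCast_holds f (q + 3 / 4) (-1),
          show q + 3 / 4 + ((-1 : ℤ) : ℚ) + 1 / 4 = q by push_cast; ring] at h1
        rw [h1]
      rw [key]
      -- `d_{γ'} ≡ 1 (mod c₀)`: `N' = 4c₀ ∣ c`, `c ∣ 4(d' − d)`, `d ≡ 1 (mod N')`
      refine cuspSymbol_mem_periodLatticeGamma1_of_dvd_sub_one f hNc γN ?_
      rw [hcoe]
      have hN'c' : (N' : ℤ) = 4 * (c₀ : ℤ) := by exact_mod_cast hN'c
      have hcN' : (N' : ℤ) ∣ (γ : SL(2, ℤ)) 1 0 := by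
        have hh := γ.2
        rw [Gamma0_mem, ZMod.intCast_zmod_eq_zero_iff_dvd] at hh
        exact hh
      have hA : (c₀ : ℤ) ∣ ((γ' : SL(2, ℤ)) 1 1 : ℤ) - ((γ : SL(2, ℤ)) 1 1 : ℤ) := by
        have h4 : (4 : ℤ) * c₀ ∣ 4 * ((((γ' : SL(2, ℤ)) 1 1 : ℤ) - ((γ : SL(2, ℤ)) 1 1 : ℤ))) :=
          (hN'c' ▸ hcN').trans (by simpa using h11)
        exact (mul_dvd_mul_iff_left (by norm_num : (4 : ℤ) ≠ 0)).mp h4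
      have hB : (c₀ : ℤ) ∣ ((γ : SL(2, ℤ)) 1 1 : ℤ) - 1 := by
        have hh := (ZMod.intCast_eq_intCast_iff_dvd_sub 1 _ N').mp (by rw [hd1]; simp)
        exact (Dvd.intro_left _ hN'c'.symm).trans hh
      have := dvd_add hA hB
      rwa [sub_add_sub_cancel] at this
  | zero => rw [mul_zero]; exact AddSubgroup.zero_mem _
  | add x y _ _ hx hy => rw [mul_add]; exact AddSubgroup.add_mem _ hx hy
  | neg x _ hx => rw [mul_neg]; exact AddSubgroup.neg_mem _ hx

/-! ## §2 The hard inclusion `Λ₁(f) ⊆ s·Λ₁(g)` -/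

/-- **`Λ₁(f) ⊆ s·Λ₁(g)`** (`N ∣ N′ ∣ 4N`, `16 ∣ N′`): a `Γ₁(N)`-period `{∞, γ∞}_f` is, after coset descent (same `d ≡ 1 (mod N)`,
`4N ∣ c`), `s{∞, a/c + ¼}_g = s{∞, γ″∞}_g` with Shimura's `γ″ ∈ Γ₀(N′)`, `d_{γ″} ≡ d ≡ 1 (mod N′/4)`; cuspidal inertia at
`c₀ = N′/4` (`N′ ∣ c₀²` as `16 ∣ N′`) puts `{∞, γ″∞}_g` in `Λ₁(g)`. [cite: Stevens1989, Lemma (5.4) p. 97] [cite: Shimura1971, Prop. 3.64] -/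
theorem periodLatticeGamma1_le_smul_of_quarterShift {N N' : ℕ} [NeZero N] [NeZero N'] (hNN' : N ∣ N')
    (hN'4 : N' ∣ 4 * N) (h16 : 4 ^ 2 ∣ N') {s : ℂ} {f : CuspForm (Gamma0 N) 2} {g : CuspForm (Gamma0 N') 2}
    (h : QuarterShiftSymbols s f g) :
    ∀ z ∈ periodLatticeGamma1 f, ∃ w ∈ periodLatticeGamma1 g, z = s * w := by
  haveI : NeZero (4 : ℕ) := ⟨by norm_num⟩
  obtain ⟨c₀, hN'c, hcN, -, hN'c2⟩ := exists_quarter_level hNN' hN'4 h16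
  have h2 : 2 ∣ N := by
    obtain ⟨a, ha⟩ := dvd_trans h16 hN'4
    norm_num at ha
    exact ⟨2 * a, by omega⟩
  intro z hz
  induction hz using AddSubgroup.closure_induction with
  | mem x hx =>
    obtain ⟨γ₁, rfl⟩ := hx
    change ∃ w ∈ periodLatticeGamma1 g, cuspSymbol f ⟨(γ₁ : SL(2, ℤ)), Gamma1_in_Gamma0 N γ₁.2⟩ = s * w
    set δ : Gamma0 N := ⟨(γ₁ : SL(2, ℤ)), Gamma1_in_Gamma0 N γ₁.2⟩ with hδdef
    have hγ1 := (Gamma1_mem N (γ₁ : SL(2, ℤ))).mp γ₁.2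
    have hd1 : (((δ : SL(2, ℤ)) 1 1 : ℤ) : ZMod N) = 1 := hγ1.2.1
    obtain ⟨δ₁, hδ₁, hd11, hEq⟩ := exists_mem_gamma0_four_mul_apply_eq_cuspSymbol_eq h2 f δ
    rw [hEq]
    have hδ₁' : (δ₁ : SL(2, ℤ)) ∈ Gamma0 N' := mem_gamma0_of_dvd hN'4 hδ₁
    set γ' : Gamma0 N' := ⟨(δ₁ : SL(2, ℤ)), hδ₁'⟩ with hγ'
    have hcoe : (γ' : SL(2, ℤ)) = (δ₁ : SL(2, ℤ)) := rfl
    by_cases hc0 : (δ₁ : SL(2, ℤ)) 1 0 = 0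
    · refine ⟨0, AddSubgroup.zero_mem _, ?_⟩
      rw [cuspSymbol, if_pos hc0, mul_zero]
    · obtain ⟨γ'', h10, h11, hdiv⟩ := exists_gamma0_cusp_add_twistShift_apply h16 γ' (by rw [hcoe]; exact hc0) (1 : ZMod 4)
      rw [Summit.BirchSwinnertonDyer.Rank1Residual.ManinAdditive.twistShift_one_four, hcoe] at hdiv
      rw [hcoe] at h10 h11
      have hc0'' : (γ'' : SL(2, ℤ)) 1 0 ≠ 0 := by rw [h10]; exact hc0
      refine ⟨cuspSymbol g γ'', ?_, ?_⟩
      · -- `d_{γ''} ≡ 1 (mod c₀)`: `4N ∣ c`, `c₀ ∣ N`, `c ∣ 4(d'' − d)`, `d ≡ 1 (mod N)`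
        refine cuspSymbol_mem_periodLatticeGamma1_of_dvd_sub_one g hN'c2 γ'' ?_
        have hc4N : ((4 * N : ℕ) : ℤ) ∣ (δ₁ : SL(2, ℤ)) 1 0 := by
          have hh := hδ₁
          rw [Gamma0_mem, ZMod.intCast_zmod_eq_zero_iff_dvd] at hh
          exact hh
        have hc₀N : (c₀ : ℤ) ∣ (N : ℤ) := Int.natCast_dvd_natCast.mpr hcN
        have hA : (c₀ : ℤ) ∣ ((γ'' : SL(2, ℤ)) 1 1 : ℤ) - ((δ₁ : SL(2, ℤ)) 1 1 : ℤ) := by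
          have h4 : (4 : ℤ) * c₀ ∣ 4 * ((((γ'' : SL(2, ℤ)) 1 1 : ℤ) - ((δ₁ : SL(2, ℤ)) 1 1 : ℤ))) := by
            refine dvd_trans ?_ (hc4N.trans (by simpa using h11))
            push_cast
            exact mul_dvd_mul_left 4 hc₀N
          exact (mul_dvd_mul_iff_left (by norm_num : (4 : ℤ) ≠ 0)).mp h4
        have hB : (c₀ : ℤ) ∣ ((δ₁ : SL(2, ℤ)) 1 1 : ℤ) - 1 := by
          rw [hd11]
          have hh := (ZMod.intCast_eq_intCast_iff_dvd_sub 1 _ N).mp (by rw [hd1]; simp)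
          exact hc₀N.trans hh
        have := dvd_add hA hB
        rwa [sub_add_sub_cancel] at this
      · rw [cuspSymbol_eq_of_ne_zero f δ₁ hc0, cuspSymbol_eq_of_ne_zero g γ'' hc0'', hdiv]
        exact h _
  | zero => exact ⟨0, AddSubgroup.zero_mem _, by rw [mul_zero]⟩
  | add x y _ _ hx hy =>
    obtain ⟨w₁, hw₁, rfl⟩ := hx
    obtain ⟨w₂, hw₂, rfl⟩ := hy
    exact ⟨w₁ + w₂, AddSubgroup.add_mem _ hw₁ hw₂, by rw [mul_add]⟩
  | neg x _ hx =>
    obtain ⟨w, hw, rfl⟩ := hx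
    exact ⟨-w, AddSubgroup.neg_mem _ hw, by rw [mul_neg]⟩

/-! ## §3 `Λ₁(g) = s⁻¹·Λ₁(f)` exactly, and the map form -/

/-- **THE `Γ₁` QUARTER-SHIFT TRANSFER: `w ∈ Λ₁(g) ⟺ s·w ∈ Λ₁(f)`** (`N ∣ N′ ∣ 4N`, `16 ∣ N′`, `s ≠ 0`). -/
theorem periodLatticeGamma1_iff_of_quarterShift {N N' : ℕ} [NeZero N] [NeZero N'] (hNN' : N ∣ N')
    (hN'4 : N' ∣ 4 * N) (h16 : 4 ^ 2 ∣ N') {s : ℂ} (hs : s ≠ 0) {f : CuspForm (Gamma0 N) 2}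
    {g : CuspForm (Gamma0 N') 2} (h : QuarterShiftSymbols s f g) :
    ∀ w : ℂ, w ∈ periodLatticeGamma1 g ↔ s * w ∈ periodLatticeGamma1 f := by
  intro w
  refine ⟨smul_periodLatticeGamma1_le_of_quarterShift hNN' hN'4 h16 h w, fun hw ↦ ?_⟩
  obtain ⟨w', hw', hEq⟩ := periodLatticeGamma1_le_smul_of_quarterShift hNN' hN'4 h16 h _ hw
  rwa [mul_left_cancel₀ hs hEq]

/-- Map form: `Λ₁(f) = (w ↦ s·w)(Λ₁(g))` as additive subgroups of `ℂ`. -/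
theorem periodLatticeGamma1_eq_map_of_quarterShift {N N' : ℕ} [NeZero N] [NeZero N'] (hNN' : N ∣ N')
    (hN'4 : N' ∣ 4 * N) (h16 : 4 ^ 2 ∣ N') {s : ℂ} {f : CuspForm (Gamma0 N) 2}
    {g : CuspForm (Gamma0 N') 2} (h : QuarterShiftSymbols s f g) :
    periodLatticeGamma1 f = (periodLatticeGamma1 g).map (AddMonoidHom.mulLeft s) := by
  ext z
  rw [AddSubgroup.mem_map]
  constructor
  · intro hz
    obtain ⟨w, hw, rfl⟩ := periodLatticeGamma1_le_smul_of_quarterShift hNN' hN'4 h16 h z hz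
    exact ⟨w, hw, rfl⟩
  · rintro ⟨w, hw, rfl⟩
    exact smul_periodLatticeGamma1_le_of_quarterShift hNN' hN'4 h16 h w hw

/-- Map form of es's THEOREM 55.D: `Λ₀(f) = (w ↦ s·w)(Λ₀(g))`. -/
theorem periodLattice_eq_map_of_quarterShift {N N' : ℕ} [NeZero N] [NeZero N'] (hNN' : N ∣ N')
    (hN'4 : N' ∣ 4 * N) (h16 : 4 ^ 2 ∣ N') {s : ℂ} {f : CuspForm (Gamma0 N) 2}
    {g : CuspForm (Gamma0 N') 2} (h : QuarterShiftSymbols s f g) :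
    periodLattice f = (periodLattice g).map (AddMonoidHom.mulLeft s) := by
  ext z
  rw [AddSubgroup.mem_map]
  constructor
  · intro hz
    obtain ⟨w, hw, rfl⟩ := periodLattice_le_smul_of_quarterShift_of_dvd hN'4 h16 h z hz
    exact ⟨w, hw, rfl⟩
  · rintro ⟨w, hw, rfl⟩
    exact smul_periodLattice_le_of_quarterShift hNN' h16 h w hw

/-! ## §4 The Shimura quotient is invariant along the edge -/

/-- **THE ORDER OF THE SHIMURA QUOTIENT IS A QUARTER-SHIFT INVARIANT: `[Λ₀(f) : Λ₁(f)] = [Λ₀(g) : Λ₁(g)]`** (`s ≠ 0`; `relIndex`, so the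
statement is meaningful for any cusp forms — for newforms of elliptic curves both are finite, the order of `ker(E₁ → E₀)`).
[cite: Stevens1989, §2] -/
theorem relIndex_periodLatticeGamma1_eq_of_quarterShift {N N' : ℕ} [NeZero N] [NeZero N'] (hNN' : N ∣ N')
    (hN'4 : N' ∣ 4 * N) (h16 : 4 ^ 2 ∣ N') {s : ℂ} (hs : s ≠ 0) {f : CuspForm (Gamma0 N) 2}
    {g : CuspForm (Gamma0 N') 2} (h : QuarterShiftSymbols s f g) :
    (periodLatticeGamma1 f).relIndex (periodLattice f) = (periodLatticeGamma1 g).relIndex (periodLattice g) := by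
  rw [periodLatticeGamma1_eq_map_of_quarterShift hNN' hN'4 h16 h, periodLattice_eq_map_of_quarterShift hNN' hN'4 h16 h]
  exact AddSubgroup.relIndex_map_map_of_injective _ _ (mul_right_injective₀ hs)

/-- **«Stevens' curve = the optimal curve» is a quarter-shift invariant: `Λ₁(g) = Λ₀(g) ⟺ Λ₁(f) = Λ₀(f)`** (`s ≠ 0`). -/
theorem periodLatticeGamma1_eq_iff_of_quarterShift {N N' : ℕ} [NeZero N] [NeZero N'] (hNN' : N ∣ N')
    (hN'4 : N' ∣ 4 * N) (h16 : 4 ^ 2 ∣ N') {s : ℂ} (hs : s ≠ 0) {f : CuspForm (Gamma0 N) 2}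
    {g : CuspForm (Gamma0 N') 2} (h : QuarterShiftSymbols s f g) :
    periodLatticeGamma1 g = periodLattice g ↔ periodLatticeGamma1 f = periodLattice f := by
  constructor
  · intro hg
    refine le_antisymm (periodLatticeGamma1_le_periodLattice f) fun z hz ↦ ?_
    obtain ⟨w, hw, rfl⟩ := periodLattice_le_smul_of_quarterShift_of_dvd hN'4 h16 h z hz
    rw [← hg] at hw
    exact smul_periodLatticeGamma1_le_of_quarterShift hNN' hN'4 h16 h w hw
  · intro hf
    refine le_antisymm (periodLatticeGamma1_le_periodLattice g) fun w hw ↦ ?_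
    have h1 : s * w ∈ periodLattice f := smul_periodLattice_le_of_quarterShift hNN' h16 h w hw
    rw [← hf] at h1
    exact (periodLatticeGamma1_iff_of_quarterShift hNN' hN'4 h16 hs h w).mpr h1

/-- **Index `4` (`Λ₁ = 2Λ₀`, the negation of E-an-152b `ShimuraIndexNeFourAtFour`) is a quarter-shift invariant** (`s ≠ 0`). -/
theorem periodLatticeGamma1_eq_two_mul_iff_of_quarterShift {N N' : ℕ} [NeZero N] [NeZero N'] (hNN' : N ∣ N')
    (hN'4 : N' ∣ 4 * N) (h16 : 4 ^ 2 ∣ N') {s : ℂ} (hs : s ≠ 0) {f : CuspForm (Gamma0 N) 2}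
    {g : CuspForm (Gamma0 N') 2} (h : QuarterShiftSymbols s f g) :
    (∀ z : ℂ, z ∈ periodLatticeGamma1 g ↔ ∃ w ∈ periodLattice g, z = 2 * w) ↔
      (∀ z : ℂ, z ∈ periodLatticeGamma1 f ↔ ∃ w ∈ periodLattice f, z = 2 * w) := by
  have hΛ₀ := periodLattice_iff_of_quarterShift_of_dvd hNN' hN'4 h16 hs h
  have hΛ₁ := periodLatticeGamma1_iff_of_quarterShift hNN' hN'4 h16 hs h
  constructor
  · intro hg z
    constructor
    · intro hz
      obtain ⟨w, hw, rfl⟩ := periodLatticeGamma1_le_smul_of_quarterShift hNN' hN'4 h16 h z hz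
      obtain ⟨w₀, hw₀, rfl⟩ := (hg w).mp hw
      exact ⟨s * w₀, smul_periodLattice_le_of_quarterShift hNN' h16 h w₀ hw₀, by ring⟩
    · rintro ⟨w, hw, rfl⟩
      obtain ⟨w', hw', rfl⟩ := periodLattice_le_smul_of_quarterShift_of_dvd hN'4 h16 h w hw
      have h2 : 2 * w' ∈ periodLatticeGamma1 g := (hg _).mpr ⟨w', hw', rfl⟩
      have := smul_periodLatticeGamma1_le_of_quarterShift hNN' hN'4 h16 h _ h2
      rwa [show s * (2 * w') = 2 * (s * w') by ring] at this
  · intro hf z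
    constructor
    · intro hz
      have h1 : s * z ∈ periodLatticeGamma1 f := (hΛ₁ z).mp hz
      obtain ⟨w, hw, hEq⟩ := (hf _).mp h1
      obtain ⟨w', hw', rfl⟩ := periodLattice_le_smul_of_quarterShift_of_dvd hN'4 h16 h w hw
      refine ⟨w', hw', mul_left_cancel₀ hs ?_⟩
      rw [hEq]; ring
    · rintro ⟨w, hw, rfl⟩
      have h1 : s * w ∈ periodLattice f := (hΛ₀ w).mp hw
      have h2 : 2 * (s * w) ∈ periodLatticeGamma1 f := (hf _).mpr ⟨s * w, h1, rfl⟩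
      rw [show 2 * (s * w) = s * (2 * w) by ring] at h2
      exact (hΛ₁ _).mpr h2

end Summit.BirchSwinnertonDyer.BirchSwinnertonDyer.Theorems.ManinLocalTwoThree.SigmaHabitat

end
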